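import Mathlib
import Summits.Ventures.DiscreteObjects.Mahler.Height1CensusCells

/-!
# A sub-Lehmer slice of fixed degree is FINITE, with an explicit height bound (venture `DiscreteObjects`, target L)

Cell `pub-namedobj`, seat `pub-namedobj-mahler` (gen 7). Framing: lottery ticket; floor = certified
bounds/negative ranges.

The cell's NOT-COVERED list carried "height ≥ 2 at degree 56: no finite formulation in print"
(PLAN-L item L8-4).  Mahler's inequality `|a_k| ≤ C(n,k) · M(P)` (Mathlib:
`Polynomial.norm_coeff_le_choose_mul_mahlerMeasure`, [cite: MckeeSmyth2021, Lemma 1.7] in print)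
gives a finite formulation in the kernel: a sub-Lehmer integer polynomial of degree `≤ n` has every
coefficient bounded by `C(n, ⌊n/2⌋) · 117629 / 100000` (`height_le_of_subLehmer`), so for each `n` the
sub-Lehmer polynomials of degree `≤ n` form a FINITE set (`finite_setOf_subLehmer_natDegree_le`) —
of size far beyond any census ("beyond bound k", not "no finite formulation").  At `n = 56` the
coefficient bound is `C(56,28) · 1.17629 < 9.0 · 10¹⁵` (`height_le_of_subLehmer_56`).
-/

namespace Summit.Ventures.DiscreteObjects.Mahler

open Polynomial

/-- **Mahler's inequality over `ℤ`:** `|a_k| ≤ C(deg P, k) · M(P)`. -/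
theorem abs_coeff_le_choose_mul_intMahlerMeasure (P : ℤ[X]) (k : ℕ) :
    (|P.coeff k| : ℝ) ≤ (P.natDegree.choose k : ℝ) * intMahlerMeasure P := by
  have h := norm_coeff_le_choose_mul_mahlerMeasure k (P.map (Int.castRingHom ℂ))
  rw [coeff_map, natDegree_map_eq_of_injective (RingHom.injective_int _), eq_intCast,
    Complex.norm_intCast] at h
  exact h

/-- A sub-Lehmer integer polynomial of degree `≤ n` has `|a_k| ≤ C(n, ⌊n/2⌋) · 117629 / 100000`
(natural-number division) for every `k`. -/
theorem natAbs_coeff_le_of_subLehmer {P : ℤ[X]} (hP : SubLehmer P) {n : ℕ} (hn : P.natDegree ≤ n)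
    (k : ℕ) : (P.coeff k).natAbs ≤ n.choose (n / 2) * 117629 / 100000 := by
  have hL : intMahlerMeasure lehmerPoly < 117629 / 100000 := lehmer_measure_upper_bound
  have hM : intMahlerMeasure P < 117629 / 100000 := lt_trans hP.2 hL
  have hMnn : 0 ≤ intMahlerMeasure P := le_of_lt (lt_trans one_pos hP.1)
  have h1 := abs_coeff_le_choose_mul_intMahlerMeasure P k
  have hchoose : (P.natDegree.choose k : ℝ) ≤ (n.choose (n / 2) : ℝ) := by
    exact_mod_cast (Nat.choose_le_choose k hn).trans (Nat.choose_le_middle k n)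
  -- real inequality `|a_k| · 100000 < C · 117629` (or `C = 0` and `a_k = 0`)
  rw [Nat.le_div_iff_mul_le (by norm_num)]
  have hreal : (|P.coeff k| : ℝ) * 100000 ≤ (n.choose (n / 2) : ℝ) * 117629 := by
    have h2 : (|P.coeff k| : ℝ) ≤ (n.choose (n / 2) : ℝ) * intMahlerMeasure P :=
      h1.trans (mul_le_mul_of_nonneg_right hchoose hMnn)
    have h3 : (n.choose (n / 2) : ℝ) * intMahlerMeasure P ≤ (n.choose (n / 2) : ℝ) * (117629 / 100000) :=
      mul_le_mul_of_nonneg_left hM.le (Nat.cast_nonneg _)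
    linarith
  have hcast : ((P.coeff k).natAbs : ℝ) = (|P.coeff k| : ℝ) := by
    rw [Nat.cast_natAbs]; push_cast; rfl
  have : ((P.coeff k).natAbs * 100000 : ℕ) ≤ (n.choose (n / 2) * 117629 : ℕ) := by
    have h' : ((P.coeff k).natAbs : ℝ) * 100000 ≤ (n.choose (n / 2) : ℝ) * 117629 := by
      rw [hcast]; exact hreal
    exact_mod_cast h'
  exact this

/-- **Height bound:** a sub-Lehmer integer polynomial of degree `≤ n` has
`height ≤ C(n, ⌊n/2⌋) · 117629 / 100000`. -/
theorem height_le_of_subLehmer {P : ℤ[X]} (hP : SubLehmer P) {n : ℕ} (hn : P.natDegree ≤ n) :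
    height P ≤ n.choose (n / 2) * 117629 / 100000 :=
  (height_le_iff P _).mpr fun k => natAbs_coeff_le_of_subLehmer hP hn k

/-- At degree `56`: a sub-Lehmer integer polynomial of degree `≤ 56` has height `≤ 8 997 078 266 768 497`
(`= ⌊C(56,28) · 1.17629⌋`, kernel arithmetic). -/
theorem height_le_of_subLehmer_56 {P : ℤ[X]} (hP : SubLehmer P) (hn : P.natDegree ≤ 56) :
    height P ≤ 8997078266768497 := by
  have h := height_le_of_subLehmer hP hn
  have hc : (56 : ℕ).choose (56 / 2) * 117629 / 100000 = 8997078266768497 := by decide +kernel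
  rw [hc] at h
  exact h

/-- Integer polynomials of degree `≤ n` and height `≤ H` form a finite set. -/
theorem finite_setOf_natDegree_le_height_le (n H : ℕ) :
    {P : ℤ[X] | P.natDegree ≤ n ∧ height P ≤ H}.Finite := by
  -- coefficient vectors in a finite box
  set box : Set (Fin (n + 1) → ℤ) := {f | ∀ i, f i ∈ Set.Icc (-(H : ℤ)) H} with hbox
  have hboxfin : box.Finite := Set.Finite.pi' fun _ => Set.finite_Icc _ _
  set φ : (Fin (n + 1) → ℤ) → ℤ[X] := fun f => ∑ i : Fin (n + 1), monomial (i : ℕ) (f i) with hφ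
  apply (hboxfin.image φ).subset
  rintro P ⟨hdeg, hh⟩
  refine ⟨fun i => P.coeff i, ?_, ?_⟩
  · intro i
    have hi := (height_le_iff P H).mp hh i
    simp only [Set.mem_Icc]
    constructor <;> omega
  · simp only [hφ]
    rw [Fin.sum_univ_eq_sum_range (fun i => monomial i (P.coeff i)) (n + 1)]
    exact (as_sum_range' P (n + 1) (by omega)).symm

/-- **Finite formulation:** for every `n`, the sub-Lehmer integer polynomials of degree `≤ n` form a
finite set (of size bounded via the height bound `C(n,⌊n/2⌋) · 1.17629`). -/
theorem finite_setOf_subLehmer_natDegree_le (n : ℕ) :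
    {P : ℤ[X] | P.natDegree ≤ n ∧ SubLehmer P}.Finite :=
  (finite_setOf_natDegree_le_height_le n (n.choose (n / 2) * 117629 / 100000)).subset
    fun _ ⟨hdeg, hP⟩ => ⟨hdeg, height_le_of_subLehmer hP hdeg⟩

end Summit.Ventures.DiscreteObjects.Mahler
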